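import Summits.CriticalPhenomena.PercolationContinuityZ3.Theorems.PercNearOneGluingNoHeavyLowerTailMajorityGluingTypeTableScaledIso
import Summits.CriticalPhenomena.PercolationContinuityZ3.Theorems.PercNearOneGluingNoHeavyLowerTailMajorityGluingTypeTableStarCertificates
import Summits.CriticalPhenomena.PercolationContinuityZ3.Theorems.PercNearOneGluingNoHeavyLowerTailMajorityGluingTypeTableFixedMCell
import HarnessLib

/-!
# Template S in the kernel: the STAR rows for the scaled law (law-level real analysis)
(lane prim-rate, constants-miner 1, gen 30; census/g25/DERIVATIONS.md P2, B5; RIGOROUS-CERTIFICATION.md §4; CONVEX-BOOTSTRAP.md §2 (v))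

Support file for the closed crux `NoHeavyLowerTail` (stmt-CriticalPhenomena-4575), majority-gluing line; continuation of
`…TypeTableScaledIso` (`SLaw`, `xs`, `scal`), `…TypeTableStarCertificates` (`star{w}_theta`) and `…TypeTableFixedMCell` (`amgm4`,
`lin_sig4`).  For a law of a case with dominant relay `w` and a relay `z ≠ w`:

* `starθ` — STAR_y in product form: `θ·T_y·(Σ_{u≠y}T_u) ≤ U₄` whenever `S_y ≤ (2−θ)T_y`, `θ ≥ 0` (from `star{y}_theta`,
  `x(all cut) ≤ 1` and `E > 0`); `theta_of_code` — the band table gives `S_y ≤ (2 − 2^{-t})T_y` for every admissible code `t`;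
* `sqrt_star_scaled` — **`θ·T̂_z² ≤ M_top^{κ₀}·(Σ̂₄/4)^{4p}`** for the scaled law `x̂ = Λx` (STAR_z, `T_z ≤ T_w ≤ Σ_{u≠z}T_u`, ISO₄ +
  AM–GM, and the `μ`-free scaling identity `s₀(2c₄−4) = 4−c₄`);
* `tan_valid` — template B's tangent rows for the restricted scaled law of world B (supports avoiding `LARGE_w`).

The STAR-B chain is in `…TypeTableScaledStarB`, the rational constants and the emitted cuts in `…TypeTableScaledStarRoot` /
`…TypeTableScaledStarConst`.  No percolation, no sorries.
[cite: VandenbergHaggstromKahn2005, Thm. 1.3 (p. 6)]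
-/

namespace Summit.CriticalPhenomena.PercolationContinuityZ3.Theorems

namespace HubOnly
namespace TypeTable

open DType

noncomputable section

variable {K : ℕ} {M : ℝ} {x : DType → ℝ} {cs : SCase}

/-! ### World B: restriction of tangent rows whose supports avoid `LARGE_w` -/

/-- The isolated-set functional of a power row is nonnegative. -/
theorem PKind.uφ_nonneg (κ : PKind) (τ : DType) : 0 ≤ κ.uφ τ := by
  cases κ <;> simp only [PKind.uφ, DType.uZ, ind] <;> split <;> norm_num

/-- If both supports of a tangent row vanish on `LARGE_w`, its functional is `≥ 0` there. -/
theorem tan_restrOK {w : ℕ} {r : TRow} (h : suppOK true w r = true) : restrOK true w r.toRow.φ = true := by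
  simp only [suppOK, Bool.not_true, Bool.false_or, List.all_eq_true, Bool.or_eq_true, Bool.not_eq_true',
    Bool.and_eq_true, beq_iff_eq] at h
  simp only [restrOK, Bool.not_true, Bool.false_or, List.all_eq_true, Bool.or_eq_true, Bool.not_eq_true', decide_eq_true_eq]
  intro τ hτ
  rcases h τ hτ with hl | ⟨h1, h2⟩
  · exact Or.inl hl
  · right
    simp only [TRow.toRow, combo, List.map_cons, List.map_nil, List.sum_cons, List.sum_nil, h1, h2, mul_zero, add_zero]
    exact mul_nonneg (Int.natCast_nonneg _) (PKind.uφ_nonneg _ _)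

/-- **Tangent rows of template S.**  A row `.tan r` accepted by `SRow.ok K cs restricted` holds for the (restricted) scaled law. -/
theorem tan_valid (L : SLaw K cs M x) {rs : Bool} (r : TRow) (hok : (SRow.tan r).ok K cs rs = true) :
    lin ((SRow.tan r).toRow cs).φ (xs rs K M cs.w x) ≤ (((SRow.tan r).toRow cs).b : ℝ) := by
  simp only [SRow.ok, Bool.and_eq_true] at hok
  obtain ⟨hr, hsupp⟩ := hok
  simp only [SRow.toRow]
  have h0 := trow_valid_scaled L r hr
  cases rs
  · exact h0
  · have hφ := tan_restrOK hsupp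
    simp only [restrOK, Bool.not_true, Bool.false_or, List.all_eq_true, Bool.or_eq_true, Bool.not_eq_true',
      decide_eq_true_eq] at hφ
    have e : xs true K M cs.w x = fun τ => if τ.large cs.w then 0 else (xs false K M cs.w x) τ := by
      funext τ; simp [xs]
    rw [e]
    obtain ⟨-, hpos⟩ := L.scal_pos
    refine le_trans (lin_restrict_le (fun τ hτ hl => ?_) (fun τ => ?_)) h0
    · rcases hφ τ hτ with h' | h'
      · rw [hl] at h'; exact absurd h' (by decide)
      · exact h'
    · rw [xs_false]; exact mul_nonneg hpos.le (L.nonneg τ)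

/-! ### The band table and the richness hypothesis of STAR -/

/-- A band with a `θ`-code `c` has upper edge `1 − 2^{-c}`. -/
theorem band_tcode (b c : ℕ) (h : (band b).tcode = some c) : (band b).hi = some (1 - (1 / 2) ^ c) := by
  match b, h with
  | 0, h => simp [band, BANDS] at h ⊢; subst h; norm_num
  | 1, h => simp [band, BANDS] at h
  | 2, h => simp [band, BANDS] at h
  | n + 3, h => simp [band, BANDS] at h

/-- For an admissible code `t` (`tcodeLE (bandOf y).tcode t`): `S_y ≤ (2 − 2^{-t})·T_y`. -/
theorem theta_of_code (L : SLaw K cs M x) {y t : ℕ} (hy : y ∈ [1, 2, 3, 4]) (ht : tcodeLE (cs.bandOf y).tcode t = true) :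
    Sm y x ≤ (2 - ((1 : ℝ) / 2) ^ t) * Tm y x := by
  unfold tcodeLE at ht
  split at ht
  · rename_i c hc
    simp only [decide_eq_true_eq] at ht
    have hh := band_tcode _ c hc
    have hb := L.bandHi y hy _ hh
    have hT := (L.Tpos y hy).le
    have hpow : ((1 : ℝ) / 2) ^ t ≤ ((1 : ℝ) / 2) ^ c := pow_le_pow_of_le_one (by norm_num) (by norm_num) ht
    push_cast at hb
    nlinarith
  · exact absurd ht (by simp)

/-! ### STAR in product form -/

/-- **STAR_y in product form.**  If `S_y ≤ (2−θ)T_y` with `θ ≥ 0` then `θ·T_y·(Σ_{u≠y} T_u) ≤ U₄ = u₁₂₃₄(x)`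
(from `star{y}_theta`: `x(all cut)·3E ≤ x(all cut)·U₄ − θT_yΣ`, with `x(all cut) ≤ 1` and `E > 0`). -/
theorem starθ (L : SLaw K cs M x) {y : ℕ} (hy : y ∈ [1, 2, 3, 4]) {θ : ℝ} (hθ : 0 ≤ θ)
    (hrich : Sm y x ≤ (2 - θ) * Tm y x) :
    θ * (Tm y x * (Tm 1 x + Tm 2 x + Tm 3 x + Tm 4 x - Tm y x)) ≤ uS [1, 2, 3, 4] x := by
  have hx := L.nonneg
  obtain ⟨hB2, -, -⟩ := L.budgets
  have hA1 := ACm_le_one x hx L.norm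
  have hA0 : 0 ≤ ACm x := lin_ind_nonneg _ hx
  have hU0 : 0 ≤ uS [1, 2, 3, 4] x := lin_ind_nonneg _ hx
  have hE := L.Epos
  have hT := L.Tpos y hy
  have n12 : (1:ℕ) ≠ 2 := by norm_num
  have n13 : (1:ℕ) ≠ 3 := by norm_num
  have n14 : (1:ℕ) ≠ 4 := by norm_num
  have n23 : (2:ℕ) ≠ 3 := by norm_num
  have n24 : (2:ℕ) ≠ 4 := by norm_num
  have n34 : (3:ℕ) ≠ 4 := by norm_num
  have m1 : (1:ℕ) ∈ [1, 2, 3, 4] := by simp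
  have m2 : (2:ℕ) ∈ [1, 2, 3, 4] := by simp
  have m3 : (3:ℕ) ∈ [1, 2, 3, 4] := by simp
  have m4 : (4:ℕ) ∈ [1, 2, 3, 4] := by simp
  have key : ∀ {P : ℝ}, 0 ≤ P → ACm x * (3 * E x) ≤ ACm x * uS [1, 2, 3, 4] x - θ * (Tm y x * P) →
      θ * (Tm y x * P) ≤ uS [1, 2, 3, 4] x := by
    intro P hP h
    have h1 : ACm x * uS [1, 2, 3, 4] x ≤ uS [1, 2, 3, 4] x := by nlinarith
    have h2 : 0 ≤ ACm x * (3 * E x) := by positivity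
    linarith
  simp only [List.mem_cons, List.not_mem_nil, or_false] at hy
  rcases hy with rfl | rfl | rfl | rfl
  · have h := star1_theta x hx hθ hT hrich hB2 (L.ordRows _ (by simp [linOrd])) (L.ordRows _ (by simp [linOrd]))
      (L.ordRows _ (by simp [linOrd])) (L.hub 1 m1 2 m2 n12) (L.hub 1 m1 3 m3 n13) (L.hub 1 m1 4 m4 n14)
      (L.rel 1 m1 2 m2 n12) (L.rel 1 m1 3 m3 n13) (L.rel 1 m1 4 m4 n14)
    have e : Tm 1 x + Tm 2 x + Tm 3 x + Tm 4 x - Tm 1 x = Tm 2 x + Tm 3 x + Tm 4 x := by ring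
    rw [e]
    exact key (by have := L.Tpos 2 m2; have := L.Tpos 3 m3; have := L.Tpos 4 m4; linarith) h
  · have h := star2_theta x hx hθ hT hrich (L.linRows _ (by simp [linFree])) (L.linRows _ (by simp [linFree]))
      (L.linRows _ (by simp [linFree])) (L.hub 2 m2 1 m1 n12.symm) (L.hub 2 m2 3 m3 n23) (L.hub 2 m2 4 m4 n24)
      (L.rel 2 m2 1 m1 n12.symm) (L.rel 2 m2 3 m3 n23) (L.rel 2 m2 4 m4 n24)
    have e : Tm 1 x + Tm 2 x + Tm 3 x + Tm 4 x - Tm 2 x = Tm 1 x + Tm 3 x + Tm 4 x := by ring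
    rw [e]
    exact key (by have := L.Tpos 1 m1; have := L.Tpos 3 m3; have := L.Tpos 4 m4; linarith) h
  · have h := star3_theta x hx hθ hT hrich (L.linRows _ (by simp [linFree])) (L.linRows _ (by simp [linFree]))
      (L.linRows _ (by simp [linFree])) (L.hub 3 m3 1 m1 n13.symm) (L.hub 3 m3 2 m2 n23.symm) (L.hub 3 m3 4 m4 n34)
      (L.rel 3 m3 1 m1 n13.symm) (L.rel 3 m3 2 m2 n23.symm) (L.rel 3 m3 4 m4 n34)
    have e : Tm 1 x + Tm 2 x + Tm 3 x + Tm 4 x - Tm 3 x = Tm 1 x + Tm 2 x + Tm 4 x := by ring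
    rw [e]
    exact key (by have := L.Tpos 1 m1; have := L.Tpos 2 m2; have := L.Tpos 4 m4; linarith) h
  · have h := star4_theta x hx hθ hT hrich (L.linRows _ (by simp [linFree])) (L.linRows _ (by simp [linFree]))
      (L.linRows _ (by simp [linFree])) (L.hub 4 m4 1 m1 n14.symm) (L.hub 4 m4 2 m2 n24.symm) (L.hub 4 m4 3 m3 n34.symm)
      (L.rel 4 m4 1 m1 n14.symm) (L.rel 4 m4 2 m2 n24.symm) (L.rel 4 m4 3 m3 n34.symm)
    have e : Tm 1 x + Tm 2 x + Tm 3 x + Tm 4 x - Tm 4 x = Tm 1 x + Tm 2 x + Tm 3 x := by ring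
    rw [e]
    exact key (by have := L.Tpos 1 m1; have := L.Tpos 2 m2; have := L.Tpos 3 m3; linarith) h

/-- `T_a ≤ Σ_{u ≠ b} T_u` for relays `a ≠ b` (the sum of the other three layers contains `T_a`; all layers are positive). -/
theorem T_le_others (L : SLaw K cs M x) {a b : ℕ} (ha : a ∈ [1, 2, 3, 4]) (hb : b ∈ [1, 2, 3, 4]) (hab : a ≠ b) :
    Tm a x ≤ Tm 1 x + Tm 2 x + Tm 3 x + Tm 4 x - Tm b x := by
  have p1 := (L.Tpos 1 (by simp)).le; have p2 := (L.Tpos 2 (by simp)).le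
  have p3 := (L.Tpos 3 (by simp)).le; have p4 := (L.Tpos 4 (by simp)).le
  simp only [List.mem_cons, List.not_mem_nil, or_false] at ha hb
  rcases ha with rfl | rfl | rfl | rfl <;> rcases hb with rfl | rfl | rfl | rfl <;>
    first | exact absurd rfl hab | linarith

/-- `T_w ≤ Σ_{u ≠ z} T_u` for `z ≠ w`. -/
theorem Tw_le_others (L : SLaw K cs M x) {z : ℕ} (hz : z ∈ [1, 2, 3, 4]) (hzw : z ≠ cs.w) :
    Tm cs.w x ≤ Tm 1 x + Tm 2 x + Tm 3 x + Tm 4 x - Tm z x :=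
  T_le_others L L.wmem hz (fun h => hzw h.symm)

/-- A non-dominant relay's layer is at most the sum of the other layers: `T_z ≤ T_w ≤ Σ_{u≠z} T_u`. -/
theorem Tz_le_others (L : SLaw K cs M x) {z : ℕ} (hz : z ∈ [1, 2, 3, 4]) (hzw : z ≠ cs.w) :
    Tm z x ≤ Tm 1 x + Tm 2 x + Tm 3 x + Tm 4 x - Tm z x :=
  (L.dom z hz).trans (Tw_le_others L hz hzw)

/-! ### ISO₄ with AM–GM; the scaling identity -/

/-- `Σ₄` and `Σ₃(w)` are sums of indicators: nonnegative typewise. -/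
theorem sig_nonneg_pt : ∀ τ ∈ allTypes, 0 ≤ sig4φ τ ∧ ∀ w ∈ [1, 2, 3, 4], 0 ≤ sig3φ w τ := by decide +kernel

/-- `0 ≤ Σ₄(x)` and `0 ≤ Σ₃(w)(x)` for a nonnegative law. -/
theorem sig_nonneg {x : DType → ℝ} (hx : ∀ τ, 0 ≤ x τ) {w : ℕ} (hw : w ∈ [1, 2, 3, 4]) :
    0 ≤ lin sig4φ x ∧ 0 ≤ lin (sig3φ w) x :=
  ⟨lin_nonneg (fun τ hτ => (sig_nonneg_pt τ hτ).1) hx, lin_nonneg (fun τ hτ => (sig_nonneg_pt τ hτ).2 w hw) hx⟩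

/-- ISO₄ + AM–GM: `U₄^{c₄} ≤ M^{4−c₄}·(Σ₄/4)^4`. -/
theorem iso4_amgm (L : SLaw K cs M x) :
    uS [1, 2, 3, 4] x ^ ((3 + Real.sqrt (11 / 3)) / 2) ≤
      M ^ (4 - (3 + Real.sqrt (11 / 3)) / 2) * (lin sig4φ x / 4) ^ (4 : ℕ) := by
  have hx := L.nonneg
  have h := L.iso4
  have hK : 0 ≤ M ^ (4 - (3 + Real.sqrt (11 / 3)) / 2) := Real.rpow_nonneg L.Mpos.le _
  have s1 : 0 ≤ Sm 1 x + Tm 1 x := add_nonneg (lin_ind_nonneg _ hx) (lin_ind_nonneg _ hx)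
  have s2 : 0 ≤ Sm 2 x + Tm 2 x := add_nonneg (lin_ind_nonneg _ hx) (lin_ind_nonneg _ hx)
  have s3 : 0 ≤ Sm 3 x + Tm 3 x := add_nonneg (lin_ind_nonneg _ hx) (lin_ind_nonneg _ hx)
  have s4 : 0 ≤ Sm 4 x + Tm 4 x := add_nonneg (lin_ind_nonneg _ hx) (lin_ind_nonneg _ hx)
  have ha := amgm4 s1 s2 s3 s4
  rw [lin_sig4]
  calc _ ≤ M ^ (4 - (3 + Real.sqrt (11 / 3)) / 2) * ((Sm 1 x + Tm 1 x) * (Sm 2 x + Tm 2 x) * (Sm 3 x + Tm 3 x) * (Sm 4 x + Tm 4 x)) := by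
        linarith [h]
    _ ≤ _ := mul_le_mul_of_nonneg_left ha hK

/-- **The `μ`-free scaling identity**: `s₀·(2c₄ − 4) = 4 − c₄`. -/
theorem s0_identity : s0 * (2 * ((3 + Real.sqrt (11 / 3)) / 2) - 4) = 4 - (3 + Real.sqrt (11 / 3)) / 2 := by
  have hc := ConvexBootstrap.two_lt_c4
  unfold s0 C4r
  generalize (3 + Real.sqrt (11 / 3)) / 2 = C at hc ⊢
  have hc0 : C ≠ 0 := by linarith
  have hd : 2 * C - 4 ≠ 0 := by linarith
  have e : (4 * (1 / C) - 1) / (2 - 4 * (1 / C)) = (4 - C) / (2 * C - 4) := by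
    rw [div_eq_div_iff (by
      intro h0
      have : (2 - 4 * (1 / C)) * C = 0 := by rw [h0, zero_mul]
      have e2 : (2 - 4 * (1 / C)) * C = 2 * C - 4 := by field_simp
      rw [e2] at this; exact hd this) hd]
    field_simp
  rw [e, div_mul_cancel₀ _ hd]

/-- **Scaling of a STAR inequality**: from `V·u^c ≤ M^{4−c₄}·W·s^n` for the law (`u, s ≥ 0` masses scaling with `Λ`, `V, W ≥ 0`
constants, `n = 4` with `u` of degree two resp. `n = 3` with `u^{c}` of total degree `2c₄ − 1`), the scaled inequality at `M_top`.
Stated in the two shapes used below. -/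
theorem scaled_star4 (L : SLaw K cs M x) {θ T s : ℝ} (hθ : 0 ≤ θ) (hs : 0 ≤ s)
    (h : (θ * T ^ 2) ^ ((3 + Real.sqrt (11 / 3)) / 2) ≤ M ^ (4 - (3 + Real.sqrt (11 / 3)) / 2) * s ^ (4 : ℕ)) :
    (θ * (scal K M * T) ^ 2) ^ ((3 + Real.sqrt (11 / 3)) / 2) ≤ Mtop K ^ (4 - (3 + Real.sqrt (11 / 3)) / 2) * (scal K M * s) ^ (4 : ℕ) := by
  set c := (3 + Real.sqrt (11 / 3)) / 2 with hcdef
  set b := 4 - c with hbdef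
  obtain ⟨hl1, -, hLpos⟩ := scal_facts (K := K) L.Mpos L.Mle
  have hlampos : 0 < Mtop K / M := lt_of_lt_of_le zero_lt_one hl1
  have hL : scal K M = (Mtop K / M) ^ s0 := rfl
  have hc2 : 2 < c := ConvexBootstrap.two_lt_c4
  have hc0 : 0 < c := by linarith
  have hθT : 0 ≤ θ * T ^ 2 := mul_nonneg hθ (sq_nonneg T)
  -- LHS = (Λ²)^c (θT²)^c
  have e1 : θ * (scal K M * T) ^ 2 = (scal K M) ^ 2 * (θ * T ^ 2) := by ring
  have e2 : ((scal K M) ^ 2 * (θ * T ^ 2)) ^ c = ((Mtop K / M) ^ (2 * s0 * c)) * (θ * T ^ 2) ^ c := by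
    rw [Real.mul_rpow (sq_nonneg _) hθT, hL]
    congr 1
    rw [← Real.rpow_natCast, ← Real.rpow_mul hlampos.le, ← Real.rpow_mul hlampos.le]
    congr 1; push_cast; ring
  -- RHS = lam^{4 s0 + b} M^b s^4
  have e3 : Mtop K ^ b * (scal K M * s) ^ (4 : ℕ) = (Mtop K / M) ^ (4 * s0 + b) * (M ^ b * s ^ (4 : ℕ)) := by
    have eM : Mtop K ^ b = (Mtop K / M) ^ b * M ^ b := by
      rw [← Real.mul_rpow hlampos.le L.Mpos.le, div_mul_cancel₀ _ (ne_of_gt L.Mpos)]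
    rw [eM, hL, mul_pow, ← Real.rpow_natCast ((Mtop K / M) ^ s0), ← Real.rpow_mul hlampos.le,
      show 4 * s0 + b = s0 * ((4 : ℕ) : ℝ) + b by push_cast; ring, Real.rpow_add hlampos]
    ring
  have step1 : (Mtop K / M) ^ (2 * s0 * c) * (θ * T ^ 2) ^ c ≤ (Mtop K / M) ^ (2 * s0 * c) * (M ^ b * s ^ (4 : ℕ)) :=
    mul_le_mul_of_nonneg_left h (Real.rpow_nonneg hlampos.le _)
  have hexp : 2 * s0 * c ≤ 4 * s0 + b := by
    have := s0_identity; rw [← hcdef] at this; rw [hbdef]; nlinarith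
  have step2 : (Mtop K / M) ^ (2 * s0 * c) ≤ (Mtop K / M) ^ (4 * s0 + b) :=
    Real.rpow_le_rpow_of_exponent_le hl1 hexp
  have hP0 : 0 ≤ M ^ b * s ^ (4 : ℕ) := mul_nonneg (Real.rpow_nonneg L.Mpos.le _) (pow_nonneg hs _)
  rw [e1, e2, e3]
  exact step1.trans (mul_le_mul_of_nonneg_right step2 hP0)

/-! ### The sqrt-STAR chain -/

/-- **sqrt-STAR for the scaled law.**  For a non-dominant relay `z` with an admissible code `t` (`θ = 2^{-t} ≤ θ_z`):
`(θ·T̂_z²)^{c₄} ≤ M_top^{4−c₄}·(Σ̂₄/4)^4` (`T̂_z`, `Σ̂₄` the masses of `x̂ = Λx`). -/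
theorem sqrt_star_scaled (L : SLaw K cs M x) {z : ℕ} (hz : z ∈ [1, 2, 3, 4]) (hzw : z ≠ cs.w) {t : ℕ}
    (ht : tcodeLE (cs.bandOf z).tcode t = true) :
    (((1 : ℝ) / 2) ^ t * (Tm z (xs false K M cs.w x)) ^ 2) ^ ((3 + Real.sqrt (11 / 3)) / 2) ≤
      Mtop K ^ (4 - (3 + Real.sqrt (11 / 3)) / 2) * (lin sig4φ (xs false K M cs.w x) / 4) ^ (4 : ℕ) := by
  have hx := L.nonneg
  set θ : ℝ := ((1 : ℝ) / 2) ^ t with hθdef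
  have hθ : 0 ≤ θ := by positivity
  have hrich := theta_of_code L hz ht
  have h1 := starθ L hz hθ hrich
  have hTz := (L.Tpos z hz).le
  have hoth := Tz_le_others L hz hzw
  have h2 : θ * Tm z x ^ 2 ≤ uS [1, 2, 3, 4] x := by
    have : θ * (Tm z x * Tm z x) ≤ θ * (Tm z x * (Tm 1 x + Tm 2 x + Tm 3 x + Tm 4 x - Tm z x)) :=
      mul_le_mul_of_nonneg_left (mul_le_mul_of_nonneg_left hoth hTz) hθ
    rw [sq]; exact this.trans h1
  have h3 := iso4_amgm L
  have hc0 : 0 ≤ (3 + Real.sqrt (11 / 3)) / 2 := by positivity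
  have h4 : (θ * Tm z x ^ 2) ^ ((3 + Real.sqrt (11 / 3)) / 2) ≤
      M ^ (4 - (3 + Real.sqrt (11 / 3)) / 2) * (lin sig4φ x / 4) ^ (4 : ℕ) :=
    (Real.rpow_le_rpow (mul_nonneg hθ (sq_nonneg _)) h2 hc0).trans h3
  have hs : 0 ≤ lin sig4φ x / 4 := div_nonneg (sig_nonneg hx L.wmem).1 (by norm_num)
  have h5 := scaled_star4 L hθ hs h4
  have eT : Tm z (xs false K M cs.w x) = scal K M * Tm z x := lin_xs _ _
  have eS : lin sig4φ (xs false K M cs.w x) / 4 = scal K M * (lin sig4φ x / 4) := by rw [lin_xs]; ring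
  rw [eT, eS]
  exact h5

end

end TypeTable
end HubOnly

end Summit.CriticalPhenomena.PercolationContinuityZ3.Theorems
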